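import Summits.HodgeConjecture.HodgeConjecture.Theses.EndoscopicMiddleDegree
import Literature.AlgebraicGeometry.HodgeTheory.ComplexGysinCorrespondence
import HarnessLib

/-!
# Crux `EndoscopicMiddleDegree.OrthogonalEnveloped` (stmt-HodgeConjecture-14300) — ideator 2, round 1

Scratch file of planner-cruxidea-stmt-HodgeConjecture-14300-2-0 (crux-ideate). It records, over the
tree's declarations only, the first checkable statements of the three idea cards filed this round:

* `thetaWorld`, `envelope`, `OrthogonalEnvelopedCorr`, `orthogonalEnveloped_iff_corr` — the crux with
  its inline correspondence action named as the tree's `corrAction` (pure bookkeeping, `Iff.rfl`);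
* card `hodge-tate-legible-envelope`: `OrthogonalEnvelopedByProjector` (the normal form the rigidity
  argument starts from: the envelope may be taken IDEMPOTENT) and `orthogonalEnveloped_of_byProjector`
  (proved), `ProjectorUpgrade` (the converse, first stub of that line, stated);
* card `touch-once-level-free`: `allOrNothing` and `touchOnce_vanishing` (proved linear algebra: a
  simple Hecke module touched by the theta world lies inside it; Hodge–Riemann then kills the
  component of a theta-orthogonal class);
* card `chi-zero-separation`: `kottwitzSign`, `chiZero_separates`, `memberDegrees`,
  `middle_mem_memberDegrees_iff` (proved combinatorial shadow of the purity census: the discrete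
  series `A(n,n)` is the only Adams–Johnson member with sign `−1` at the middle character, and a
  block of even size never reaches degree `2n`).
-/

noncomputable section

open CategoryTheory MonoidalCategory CartesianMonoidalCategory
open Literature.AlgebraicGeometry Literature.AlgebraicGeometry.HodgeTheory
open Literature.AlgebraicGeometry.ShimuraVarieties
open Literature.AlgebraicTopology.SingularHomology

namespace Summit.HodgeConjecture.HodgeConjecture.Cruxes.OrthogonalEnveloped.IdeatorTwo

open Summit.HodgeConjecture.HodgeConjecture.Theses.EndoscopicMiddleDegree

/-! ### The crux, with its correspondence action named -/

/-- **The theta world `TW(D)`** of the crux (verbatim its three summands): special cycle classes of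
codimension `n = m+1`; classes supported on codimension-`n` closed subsets of the codimension-`m`
special cycles; `Hdg^{m,m}_ℚ ∪ N¹`. [cite: arXiv:1306.1515, Introduction Thm 4] -/
def thetaWorld (m : ℕ) (X : Motives.SchemeOver ℂ) (D : UnitaryBallQuotientDatum (2 * (m + 1)) X) :
    Submodule ℂ (complexBetti X (2 * (m + 1))) :=
  ((⨆ (W : Submodule D.E (Fin (2 * (m + 1) + 1) → D.E))
      (_ : IsTotallyPositive (conjRingHom D.E) D.H W) (_ : Module.finrank D.E W = m + 1),
      classesSupportedOn X (D.specialSubvariety W) (2 * (m + 1))) ⊔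
    (⨆ (W : Submodule D.E (Fin (2 * (m + 1) + 1) → D.E))
      (_ : IsTotallyPositive (conjRingHom D.E) D.H W) (_ : Module.finrank D.E W = m) (Z : Set X.left)
      (_ : IsClosed Z) (_ : Z ⊆ D.specialSubvariety W)
      (_ : ∀ z ∈ Z, ((m + 1 : ℕ) : ℕ∞) ≤ Order.coheight z), classesSupportedOn X Z (2 * (m + 1))) ⊔
    Submodule.span ℂ {z : complexBetti X (2 * (m + 1)) | ∃ a : complexBetti X (2 * m),
      IsRationalClass a ∧ IsOfHodgeType (2 * (m + 1)) X (2 * m) m m a ∧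
        ∃ d ∈ algebraicClasses X 1, z = cupProduct (two_mul_add_two_mul m 1) a d})

/-- **The envelope action** `P_γ β = pr₁₊(pr₂^* β ∪ γ)` of a class `γ ∈ H^{4n}((X ⊗ X)(ℂ))` on the
middle cohomology `H^{2n}(X(ℂ))`, `2n = 2(m+1) = dim X`: the tree's `corrAction` in degrees
`a = b = 2n`, `e = 2n`. [cite: VoisinHodgeII2003, proof of Thm. 10.17 (10.7)] -/
abbrev envelope (μ : OrientationFamily) {m : ℕ} {X : Motives.SchemeOver ℂ}
    (D : UnitaryBallQuotientDatum (2 * (m + 1)) X) (γ : complexBetti (X ⊗ X) (2 * (2 * (m + 1)))) :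
    complexBetti X (2 * (m + 1)) →ₗ[ℂ] complexBetti X (2 * (m + 1)) :=
  corrAction μ D.isSmoothProjective D.isSmoothProjective
    (rfl : 2 * (m + 1) + 2 * (2 * (m + 1)) = 2 * (m + 1) + 2 * (2 * (m + 1))) γ

/-- The crux `OrthogonalEnveloped` with `TW(D)` and `P_γ` named. [cite: arXiv:1306.1515, Introduction Thm 4] -/
def OrthogonalEnvelopedCorr : Prop :=
  ∀ (μ : OrientationFamily), μ.HasPoincareDuality → ∀ (m : ℕ) (X : Motives.SchemeOver ℂ)
    (D : UnitaryBallQuotientDatum (2 * (m + 1)) X), 1 ≤ m → m ≤ 2 →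
    ∀ e : complexBetti X (2 * (m + 1)), IsRationalClass e →
      IsOfHodgeType (2 * (m + 1)) X (2 * (m + 1)) (m + 1) (m + 1) e →
      (∀ x ∈ thetaWorld m X D, cupProduct (two_mul_add_two_mul (m + 1) (m + 1)) e x = 0) →
      ∃ γ ∈ algebraicClasses (X ⊗ X) (2 * (m + 1)),
        (∀ β, IsRationalClass β → IsRationalClass (envelope μ D γ β)) ∧
        (∀ β, IsOfHodgeType (2 * (m + 1)) X (2 * (m + 1)) (m + 1) (m + 1) (envelope μ D γ β)) ∧
        envelope μ D γ e = e

/-- The named form IS the crux (definitional bookkeeping: `corrAction_apply` is `rfl`). [folklore] -/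
theorem orthogonalEnveloped_iff_corr : OrthogonalEnveloped ↔ OrthogonalEnvelopedCorr :=
  Iff.rfl

/-! ### Card `hodge-tate-legible-envelope`: the envelope may be taken idempotent -/

/-- **Normal form the rigidity argument starts from**: the crux with `P_γ ∘ P_γ = P_γ` added. An
idempotent algebraic self-correspondence cuts out a homological MOTIVE `(X, P_γ)` whose Betti
realisation `Im P_γ` is, by the purity clause, of pure type `(n,n)`; the card's lever reads its
Hodge–Tate weights off the étale realisation. [cite: Andre1996Motifs, §2.1] -/
def OrthogonalEnvelopedByProjector : Prop :=
  ∀ (μ : OrientationFamily), μ.HasPoincareDuality → ∀ (m : ℕ) (X : Motives.SchemeOver ℂ)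
    (D : UnitaryBallQuotientDatum (2 * (m + 1)) X), 1 ≤ m → m ≤ 2 →
    ∀ e : complexBetti X (2 * (m + 1)), IsRationalClass e →
      IsOfHodgeType (2 * (m + 1)) X (2 * (m + 1)) (m + 1) (m + 1) e →
      (∀ x ∈ thetaWorld m X D, cupProduct (two_mul_add_two_mul (m + 1) (m + 1)) e x = 0) →
      ∃ γ ∈ algebraicClasses (X ⊗ X) (2 * (m + 1)),
        (∀ β, IsRationalClass β → IsRationalClass (envelope μ D γ β)) ∧
        (∀ β, IsOfHodgeType (2 * (m + 1)) X (2 * (m + 1)) (m + 1) (m + 1) (envelope μ D γ β)) ∧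
        (∀ β, envelope μ D γ (envelope μ D γ β) = envelope μ D γ β) ∧
        envelope μ D γ e = e

/-- Dropping idempotence: the normal form implies the crux (by name). [folklore] -/
theorem orthogonalEnveloped_of_byProjector (h : OrthogonalEnvelopedByProjector) :
    OrthogonalEnveloped := by
  refine orthogonalEnveloped_iff_corr.2 fun μ hμ m X D h1 h2 e he hH horth ↦ ?_
  obtain ⟨γ, hγ, hrat, hpure, -, hfix⟩ := h μ hμ m X D h1 h2 e he hH horth
  exact ⟨γ, hγ, hrat, hpure, hfix⟩

/-- **`ProjectorUpgrade`** (first stub of the line, STATED): the crux implies its idempotent normal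
form — replace `P_γ` by the Fitting projector `q(P_γ)` onto its non-zero generalised eigenspaces
(`q ∈ ℚ[T]` without constant term, since `P_γ` preserves the `ℚ`-form of rational classes), which is
again the action of an ALGEBRAIC class (composites and `ℚ`-combinations of algebraic
self-correspondences are algebraic — Fulton §16.1; not yet in the tree), still fixes `e`, and has
image inside `Im P_γ`. [cite: Fulton1998, §16.1 Prop. 16.1.1] -/
def ProjectorUpgrade : Prop :=
  OrthogonalEnveloped → OrthogonalEnvelopedByProjector

/-! ### Card `touch-once-level-free`: simplicity + Hodge–Riemann -/

/-- **All or nothing.** In a SIMPLE module (the rational Hodge classes `Hdg(M)` of one Hecke piece,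
simple over the rational Hecke algebra by multiplicity one and Galois transitivity), a non-zero
submodule (the theta-world classes that touch the piece) is everything. [cite: arXiv:1206.0882, Thm 2.5.2] -/
theorem allOrNothing {R M : Type*} [Ring R] [AddCommGroup M] [Module R M] [IsSimpleModule R M]
    (N : Submodule R M) (hN : N ≠ ⊥) : N = ⊤ :=
  (eq_bot_or_eq_top N).resolve_left hN

/-- **Touch once, then Hodge–Riemann.** `B` the cup pairing on `H^{2n}`, `TW` the theta world at the
level of `e`, `HdgM` the rational Hodge classes of one Hecke piece `M`, `eM` the `M`-component of `e`.
If `e ⊥ TW` (`horth`), the piece is TOUCHED so that `HdgM ⊆ TW` (`htouch`, from `allOrNothing` and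
the push-forward of special cycles), the other components of `e` are `B`-orthogonal to `HdgM`
(`hcomp`, Hecke operators are closed under `B`-adjoints) and `B` is anisotropic on `HdgM` (`hpos`,
Hodge–Riemann on rational primitive `(n,n)`-classes), then `eM = 0`. [cite: VoisinHodgeI2002, Thm 6.32] -/
theorem touchOnce_vanishing {V : Type*} [AddCommGroup V] [Module ℂ V] (B : V →ₗ[ℂ] V →ₗ[ℂ] ℂ)
    (TW : Submodule ℂ V) (HdgM : Set V) {e eM : V} (horth : ∀ t ∈ TW, B e t = 0) (hM : eM ∈ HdgM)
    (htouch : HdgM ⊆ TW) (hcomp : ∀ h ∈ HdgM, B e h = B eM h)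
    (hpos : ∀ x ∈ HdgM, B x x = 0 → x = 0) : eM = 0 :=
  hpos eM hM (by rw [← hcomp eM hM]; exact horth eM (htouch hM))

/-! ### Card `chi-zero-separation`: the combinatorial shadow of the purity census -/

/-- A block of the archimedean Arthur parameter at the non-compact place `τ₁`: the index of the global
constituent `μ_j ⊠ R_{b}` it belongs to, and its size `b`. [cite: arXiv:1507.01432, §8] -/
structure Block where
  /-- index `j` of the global constituent owning the block -/
  constituent : ℕ
  /-- size `b` of the `SL₂`-block -/
  size : ℕ

/-- **Kottwitz sign** of the Adams–Johnson member attached to block `i` (the member whose Levi has its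
non-compact factor `U(b_i − 1, 1)` at block `i`) on the generator `e_j` of `S_ψ`: `−1` iff `j` owns
block `i` (common member-independent factors dropped). [cite: arXiv:1507.01432, §8 Def. 8.2–Thm 8.4] -/
def kottwitzSign (blocks : List Block) (i : Fin blocks.length) (j : ℕ) : ℤ :=
  if (blocks.get i).constituent = j then -1 else 1

/-- **χ₀ separates `A(n,n)` from every other member.** If block `i₀` (the middle character `χ₀`, a
constituent with ONE block) is the only block of its constituent, then every other member `i ≠ i₀` has
a different sign on `e_{χ₀}`; since a finite part `π_f` pins the character of `S_ψ` (multiplicity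
formula), `π_f` pairs in degree `2n` with `A(n,n)` or with other members, never both: Tate-type pieces
are pure. [cite: arXiv:1206.0882, Thm 2.5.2] [cite: arXiv:1507.01432, §8] -/
theorem chiZero_separates (blocks : List Block) (i₀ i : Fin blocks.length)
    (huniq : ∀ i', (blocks.get i').constituent = (blocks.get i₀).constituent → i' = i₀) (hi : i ≠ i₀) :
    kottwitzSign blocks i (blocks.get i₀).constituent ≠
      kottwitzSign blocks i₀ (blocks.get i₀).constituent := by
  have hne : (blocks.get i).constituent ≠ (blocks.get i₀).constituent := fun h ↦ hi (huniq i h)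
  unfold kottwitzSign
  rw [if_neg hne, if_pos rfl]
  decide

/-- **Cohomological degrees of the member at a block of size `b`** in `U(2n,1)`: its Levi has the
non-compact factor `U(b−1,1)`, `R = dim(𝔲 ∩ 𝔭) = 2n+1−b`, and `H^•(𝔤,K; A_𝔮) ≅ H^{•−R}(ℙ^{b−1})`:
degrees `R, R+2, …, R+2(b−1)` (Vogan–Zuckerman). [cite: BorelWallach2000, Ch. VI Thm 5.3] -/
def memberDegrees (n b : ℕ) : Finset ℕ :=
  (Finset.range b).image fun k ↦ 2 * n + 1 - b + 2 * k

/-- **Parity: a block of even size never reaches the middle degree.** For `0 < b ≤ 2n+1` the member at a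
block of size `b` has cohomology in degree `2n` iff `b` is odd (`b = 1`: the discrete series;
`b = 3, 5, …`: the only non-tempered threats to purity). [cite: BorelWallach2000, Ch. VI Thm 5.3] -/
theorem middle_mem_memberDegrees_iff (n b : ℕ) (hb : b ≤ 2 * n + 1) :
    2 * n ∈ memberDegrees n b ↔ Odd b := by
  simp only [memberDegrees, Finset.mem_image, Finset.mem_range]
  constructor
  · rintro ⟨k, hk, h⟩
    exact ⟨k, by omega⟩
  · rintro ⟨k, rfl⟩
    exact ⟨k, by omega, by omega⟩

/-- `m = 2` (`U(6,1)`, `n = 3`): an `R₂`-block member lives in degrees `5, 7` only; an `R₃`-block member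
does reach degree `6`. [cite: BorelWallach2000, Ch. VI Thm 5.3] -/
example : 6 ∉ memberDegrees 3 2 ∧ 6 ∈ memberDegrees 3 3 := by decide

/-- `m = 1` (`U(4,1)`, `n = 2`): the `R₂`-block members of `ρ ⊠ R₂ ⊞ χ₀` live in degrees `3, 5`
(the ε-negative GL₂-CAP pieces are pure `(2,2)` in `H⁴`). [cite: arXiv:1409.6824, Thm 4.4] -/
example : 4 ∉ memberDegrees 2 2 ∧ memberDegrees 2 1 = {4} := by decide

end Summit.HodgeConjecture.HodgeConjecture.Cruxes.OrthogonalEnveloped.IdeatorTwo
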